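/-
Copyright: the b2b-balaban T⁴-continuum CRUX team, row NE7b leaf lineage `t4-ne7b-formalise-leaf-03` (gen 156). Project licence.
-/
import Summits.QuantumFields.BalabanUV.T4Continuum.Spine.NE7b.SupTorusEffectiveActionInstance

/-!
# THE HESSIAN OF THE TORUS EFFECTIVE ACTION IS THE BLOCK VOLUME TIMES THE NEXT-SCALE OPERATOR'S FORM: for SBTL's localised
# small-field background `σt` on the torus `(ℤ∕(n+1)s)^d`, on the open torus ball the effective action `wt ↦ S(σt wt)`
# (`S φ = ½Σ_x φ x·(Aφ)(x) + Σ_x v(φ x)`, `v′ = u`, `u′` the linearised sitewise term) is TWICE differentiable and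
# `(S∘σt)″(wt) k k′ = (n+1)^d·Σ_y (Rc(Q′((A + N′(σ(Ec wt)))(Dσ(Ec wt)(Ec k))))) y·k′ y` — (65)'s next-scale operator
# `Q′(A + N′(σ w))Dσ(w)` CONJUGATED TO THE TORUS CARRIERS; HSAH's transported-Hessian theorem fed through TEA §4 with every letter
# discharged: the branch `C¹` on the ball (INST §1), `Q′t∘Dt = 1` (SBTL), fibre-criticality along the ball (INST §2), and (63)'s
# LINEARISED FIBRE EQUATION `P((A + N′(σ w))Dσ(w) v) = 0` read on the torus as the pairing letter for `S″(σt wt)[Dt k, ·]`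
# (row NE7b, node U5c; SBTL + TDF + TEA + INST + (60) §1 BY NAME; [folklore])

Cell `pub-balaban`, sub-cell `t4`, spine estimate NE7b (`T4WeightBudget.RelWeightBound`; the cell's OWN estimate — NOT PRINTED in
[Bałaban 1983–89], NOT PROVED).  Crux-route work under `Spine/NE7b/` by a row leaf (`t4-ne7b-formalise-leaf-03` gen 156) under
FREEZE (0)'s crux-prover clause, on the row OWNER's located item ([NE7bP1-G116-HANDOFF] NEXT (3)(iii): «… its Hessian = (65)'s
next-scale operator — leaf-06's HardStep road has it ABSTRACTLY (HSAH), an instance needs the torus Dirichlet form on leaf-03's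
`Site` carriers»); NOTHING of Bałaban's is named as a Lean object, valued or asserted; no `T4Continuum/Support` leaf typed; no `def`,
no notation (the response family is Mathlib's `fderiv ℝ σ (Ec w′)`, the operators are written out); zero `sorry`.  Imports (BY NAME):
this lineage's INST `…SupTorusEffectiveActionInstance` (`hasFDerivAt_torus_background`, `pairing_of_sitewise`,
`fieldEq_periodic`; through it SBTL `exists_background_torus_localised`, TDF `torus_operator_form_symm` ∕ `sum_blockLift_mul_eq_blockAvg` ∕
`restrict_of_blockConst`, TEA `hessian_effectiveAction`, the OWNER's (60) §1 `blockConst_of_fibreProj_eq_zero` and (72)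
`sum_AX_periodic`, PTC `periodise_periodic` ∕ `natCast_mul_smul_eq`, leaf-04's HSAH).

WHY (located).  TEA §4 feeds HSAH's `hasFDerivAt_fderiv_comp_branch` on a finite carrier and reads the transported Hessian through a
LINEARISED fibre letter «`(At + u′(σt w)·)(Dt k)` pairs like the block lift of `Mt k`».  On the torus carriers that letter IS (63)'s
fibre equation for the response, `P((A + N′(σ w))(Dσ(w) v)) = 0` (SBTL's interior package), once read as «the lattice field
`(A + N′(σ w))(Dσ(w)(Ec k))` is periodic and equals its own block average» ((60) §1 `blockConst_of_fibreProj_eq_zero`) and restricted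
to the torus (TDF `restrict_of_blockConst` + `sum_blockLift_mul_eq_blockAvg`): `Mt = Rc∘Q′∘(A + N′(σ(Ec wt)))∘Dσ(Ec wt)∘Ec`, which is
(65)'s next-scale operator `Q′(A + N′)Dσ` between the torus carriers.  The response family along the ball is `w′ ↦ fderiv ℝ σ (Ec w′)`
(SBTL: `σ` is differentiable at every `Ec w′` of the open torus ball), so no choice is made.

WHAT IS PROVED ([folklore]; `ℓ^∞ := lp (fun _ : X d => ℝ) ∞`; coarse torus `Site d s`, `[NeZero s]`, fine `Site d ((n+1)*s)`;
operators ∕ carriers by DISPLAYED actions; `S := fun φ => ½·Σ_x φ x·((Rf∘A∘Ef) φ) x + Σ_x v(φ x)`):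
* §1 `periodise_periodic_side` (PTC's periodicity in the `side n • (s • t)` spelling), **`linearised_pairing`** (the linearised fibre
  equation `P(A(D(Ec k)) + N′(σ(Ec wt))(D(Ec k))) = 0` with `Ef(Dt k) = D(Ec k)`, `Ef(σt wt) = σ(Ec wt)` ⟹ TEA's `hlin`:
  `Σ_x (((Rf∘A∘Ef)(Dt k)) x + u′(σt wt x)·(Dt k) x)·h x = (n+1)^d·Σ_y (Mt k) y·((Rc∘Q′∘Ef) h) y`,
  `Mt = (Rc∘Q′)∘(A + N′(σ(Ec wt)))∘(D∘Ec)`).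
* §2 **`hessian_effectiveAction_torus_of_letters`** (ANY `σ ∕ σt ∕ Df` with: `σt = Rf∘σ∘Ec`; on the open torus ball `ball 0 ρ ∋ wt`
  `HasFDerivAt σ (Df w′) (Ec w′)`, `Rc(Q′(Ef(Dt w′ k))) = k`, the sitewise equation at `σt w′`; at `wt` the two identifications and
  the linearised fibre equation ⟹ `∃ H2, HasFDerivAt (fderiv (S∘σt)) H2 wt ∧ H2 k k′ = (n+1)^d·Σ_y (Mt k) y·k′ y`).
* §3 **`exists_effectiveAction_hessian_torus`** (`d ≥ 3`; SBTL's binders VERBATIM + a primitive `v` of `u`; every `s ≥ 1`): SBTL's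
  `Q′ ∕ A ∕ N′ ∕ σ`, carriers and `σt` re-exported with their actions, `σt 0 = 0` and SBTL's closed-ball identification (the five
  letters `σt wt ∈ closedBall 0 r`, `Ef(σt wt) = σ(Ec wt)`, `Q′(Ef(σt wt)) = Ec wt`, `Rc(Q′(Ef(σt wt))) = wt`, sitewise equation —
  they PIN `σt`: v1.1, the X-HESS chair leaf-06 g163's located HOLD-1, whose zero-background witness of the v1 package dies on
  them), AND on the open torus ball: `σ` differentiable at `Ec wt`,
  and `∃ H2, HasFDerivAt (fderiv (S∘σt)) H2 wt ∧
  H2 k k′ = (n+1)^d·Σ_y (Rc(Q′(A(Dσ(Ec wt)(Ec k)) + N′(σ(Ec wt))(Dσ(Ec wt)(Ec k))))) y·k′ y`, `Dσ := fderiv ℝ σ`.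
* §4 toy.

HONEST (what this is NOT).  Carrier bookkeeping + finite-dimensional calculus; the analysis is (63)'s (constants existential, useless by
value at small sides); no positivity ∕ floor of the Hessian is claimed here (HSAH `floor_hessian_comp_branch` would need a floor for
`S″(σt wt)` on the fibre directions — the torus Dirichlet form's coercivity, NOT typed); no minimality; cubic periods; scalar skeleton,
not the covariant operators ((A3), NC-NE7b-α UNRULED); nothing of Bałaban's.  BY-NAME EFFECT ON THE WALL: NONE.  NE7b NOT PRINTED ∕
NOT PROVED; spine PROVED 0∕9; rung (B)+1 on a FINITE torus — NOT infinite volume, NOT the mass gap, NOT Clay.  HONEST DEPENDENCY: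
continuum YM on T⁴ ⇐ BetaPertH ∧ nine spine estimates (0∕9 proved); BetaPertH ⇐ (D1) ∧ (D4) ∧ CAP+tail; G-an2-4 gates asym, D1 and
NE2∕3∕4.
-/

set_option autoImplicit false

noncomputable section

namespace Summit.QuantumFields.BalabanUV.T4Continuum.NE7b.SupTorusEffectiveActionHessian

open Set Metric Function
open scoped ENNReal NNReal Topology
open Literature.MathematicalPhysics.QuantumFieldTheory.Balaban1983to89
open B4Sect5Proof (latticeConst latticeConst_nonneg)
open B6QGQLower276 (X blk B side AX)
open B6QGQDecay237 (deltaU)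
open B5Hk103ScalarZd (nbhd deltaH)
open Summit.QuantumFields.BalabanUV.Beta.D1BFx.BlockColumnSupNorm (cHs)
open Summit.QuantumFields.BalabanUV.Beta.D1BFx.PointColumnSplit (cKL cG0 cSplit)
open Summit.QuantumFields.BalabanUV.Beta.D1BFx.PointColumnDecay (cFar)
open Beta (Site siteOf windowMap siteOf_windowMap)
open AugmentedInversePeriodic (sum_AX_periodic)
open PeriodicSupTorusCarrier (periodise_periodic natCast_mul_smul_eq)
open SupSmallFieldBackground (blockConst_of_fibreProj_eq_zero)
open SupTorusDirichletForm (torus_operator_form_symm sum_blockLift_mul_eq_blockAvg restrict_of_blockConst)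
open SupTorusEffectiveAction (hessian_effectiveAction)
open SupTorusEffectiveActionInstance (hasFDerivAt_torus_background pairing_of_sitewise)
open SupBackgroundTorusLocalised (exists_background_torus_localised)

variable {d : ℕ}

section Letters

variable (n : ℕ) (a : ℝ) (s : ℕ) [NeZero s]
  {Dop Aop Pop : lp (fun _ : X d => ℝ) ∞ →L[ℝ] lp (fun _ : X d => ℝ) ∞}
  (hD : ∀ (f : lp (fun _ : X d => ℝ) ∞) (y : X d), Dop f y = (((n : ℝ) + 1) ^ d)⁻¹ * ∑ p ∈ B n y, f p)
  (hA : ∀ (f : lp (fun _ : X d => ℝ) ∞) (p : X d), Aop f p = ∑ r ∈ nbhd n p, AX n a p r * f r)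
  (hP : ∀ (f : lp (fun _ : X d => ℝ) ∞) (p : X d), Pop f p = f p - (((n : ℝ) + 1) ^ d)⁻¹ * ∑ p' ∈ B n (blk n p), f p')
  {N' : lp (fun _ : X d => ℝ) ∞ → (lp (fun _ : X d => ℝ) ∞ →L[ℝ] lp (fun _ : X d => ℝ) ∞)} {u' : ℝ → ℝ}
  (hN' : ∀ (φ h : lp (fun _ : X d => ℝ) ∞) (p : X d), N' φ h p = u' (φ p) * h p)
  {Ef : (Site d ((n + 1) * s) → ℝ) →L[ℝ] lp (fun _ : X d => ℝ) ∞}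
  (hEf : ∀ (g : Site d ((n + 1) * s) → ℝ) (q : X d), Ef g q = g (siteOf d ((n + 1) * s) q))
  {Rf : lp (fun _ : X d => ℝ) ∞ →L[ℝ] (Site d ((n + 1) * s) → ℝ)}
  (hRf : ∀ (h : lp (fun _ : X d => ℝ) ∞) (x : Site d ((n + 1) * s)), Rf h x = h (windowMap d ((n + 1) * s) x))
  {Ec : (Site d s → ℝ) →L[ℝ] lp (fun _ : X d => ℝ) ∞}
  {Rc : lp (fun _ : X d => ℝ) ∞ →L[ℝ] (Site d s → ℝ)}
  (hRc : ∀ (h : lp (fun _ : X d => ℝ) ∞) (x : Site d s), Rc h x = h (windowMap d s x))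

/-! ## §1. The linearised fibre equation read on the torus: TEA's `hlin` -/

include hEf in
omit [NeZero s] in
/-- PTC's periodicity of a periodised torus field in the `side n • (s • t)` spelling. [folklore] -/
theorem periodise_periodic_side (g : Site d ((n + 1) * s) → ℝ) (q t : X d) :
    (Ef g : X d → ℝ) (q + side n • ((s : ℤ) • t)) = Ef g q := by
  rw [← natCast_mul_smul_eq]
  exact periodise_periodic hEf g q t

include hD hA hP hN' hEf hRf hRc in
/-- **THE LINEARISED FIBRE EQUATION IN PAIRING FORM ON THE TORUS** (TEA's `hlin`): if the response `D` at the background `σ(Ec wt)`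
satisfies (63)'s fibre equation `P(A(D(Ec k)) + N′(σ(Ec wt))(D(Ec k))) = 0` for coarse torus data, and `Ef(Dt k) = D(Ec k)`
(`Dt = Rf∘D∘Ec`), `Ef(σt wt) = σ(Ec wt)`, `σt wt = Rf(σ(Ec wt))`, then for all `k h`:
`Σ_x (((Rf∘A∘Ef)(Dt k)) x + u′(σt wt x)·(Dt k) x)·h x = (n+1)^d·Σ_y (Mt k) y·((Rc∘Q′∘Ef) h) y` with
`Mt = (Rc∘Q′)∘(A + N′(σ(Ec wt)))∘(D∘Ec)` — the next-scale operator conjugated to the torus carriers. [folklore] -/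
theorem linearised_pairing {σ : lp (fun _ : X d => ℝ) ∞ → lp (fun _ : X d => ℝ) ∞}
    {σt : (Site d s → ℝ) → (Site d ((n + 1) * s) → ℝ)} (hσt : ∀ wt, σt wt = Rf (σ (Ec wt))) {wt : Site d s → ℝ}
    (hEfσ : Ef (σt wt) = σ (Ec wt)) {D : lp (fun _ : X d => ℝ) ∞ →L[ℝ] lp (fun _ : X d => ℝ) ∞}
    (hEfD : ∀ vt, Ef (((Rf.comp D).comp Ec) vt) = D (Ec vt))
    (hfib : ∀ k : Site d s → ℝ, Pop (Aop (D (Ec k)) + N' (σ (Ec wt)) (D (Ec k))) = 0)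
    (k : Site d s → ℝ) (h : Site d ((n + 1) * s) → ℝ) :
    ∑ x, (((Rf.comp Aop).comp Ef) (((Rf.comp D).comp Ec) k) x + u' (σt wt x) * ((Rf.comp D).comp Ec) k x) * h x
      = ((n : ℝ) + 1) ^ d * ∑ y : Site d s,
          ((Rc.comp Dop).comp ((Aop + N' (σ (Ec wt))).comp (D.comp Ec))) k y * ((Rc.comp Dop).comp Ef) h y := by
  -- the lattice field `f = A(D(Ec k)) + N′(σ(Ec wt))(D(Ec k))`: block-constant by the fibre equation, periodic as a periodisation
  set f : lp (fun _ : X d => ℝ) ∞ := Aop (D (Ec k)) + N' (σ (Ec wt)) (D (Ec k)) with hf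
  have hfblk : ∀ p : X d, f p = Dop f (blk n p) := fun p => by
    rw [hD]
    exact blockConst_of_fibreProj_eq_zero n Pop hP (hfib k) p
  have hg : D (Ec k) = Ef (((Rf.comp D).comp Ec) k) := (hEfD k).symm
  have hper : ∀ q t : X d, f (q + side n • ((s : ℤ) • t)) = f q := fun q t => by
    simp only [hf, lp.coeFn_add, Pi.add_apply, hN', hg, ← hEfσ]
    rw [hA, hA, sum_AX_periodic n a s (periodise_periodic_side n s hEf _), periodise_periodic_side n s hEf,
      periodise_periodic_side n s hEf]
  -- sitewise: the integrand is `(Rf f) x`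
  have hx : ∀ x, ((Rf.comp Aop).comp Ef) (((Rf.comp D).comp Ec) k) x + u' (σt wt x) * ((Rf.comp D).comp Ec) k x = Rf f x :=
    fun x => by
      have e1 : ((Rf.comp Aop).comp Ef) (((Rf.comp D).comp Ec) k) x = Aop (D (Ec k)) (windowMap d ((n + 1) * s) x) := by
        rw [ContinuousLinearMap.comp_apply, ContinuousLinearMap.comp_apply, hRf, ← hg]
      have e2 : σt wt x = σ (Ec wt) (windowMap d ((n + 1) * s) x) := by rw [hσt, hRf]
      have e3 : ((Rf.comp D).comp Ec) k x = D (Ec k) (windowMap d ((n + 1) * s) x) := by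
        rw [ContinuousLinearMap.comp_apply, ContinuousLinearMap.comp_apply, hRf]
      rw [e1, e2, e3, hRf, hf, lp.coeFn_add, Pi.add_apply, hN']
  have hMt : ∀ y, ((Rc.comp Dop).comp ((Aop + N' (σ (Ec wt))).comp (D.comp Ec))) k y = Rc (Dop f) y := fun y => by
    simp only [ContinuousLinearMap.comp_apply, add_apply, hf]
  simp only [hx, hMt, restrict_of_blockConst n s hD hRf hRc hper hfblk]
  exact sum_blockLift_mul_eq_blockAvg n s hD hEf hRc (fun y => Rc (Dop f) y) h

/-! ## §2. The Hessian of the torus effective action, letters form -/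

include hD hA hP hN' hEf hRf hRc in
/-- **THE HESSIAN OF THE TORUS EFFECTIVE ACTION, LETTERS FORM** (TEA `hessian_effectiveAction` fed on the torus carriers): for ANY
background `σ` with torus background `σt = Rf∘σ∘Ec`, a response family `Df` on the open torus ball `ball 0 ρ ∋ wt`
(`HasFDerivAt σ (Df w′) (Ec w′)`, torus block means of the torus response `= 1`, the sitewise equation at every `σt w′`), and at `wt`
the identifications `Ef(σt wt) = σ(Ec wt)`, `Ef(Dt k) = Df wt (Ec k)` and (63)'s linearised fibre equation:
`∃ H2, HasFDerivAt (fderiv (S∘σt)) H2 wt ∧ H2 k k′ = (n+1)^d·Σ_y (Mt k) y·k′ y`, `Mt = (Rc∘Q′)∘(A + N′(σ(Ec wt)))∘(Df wt∘Ec)`. [folklore] -/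
theorem hessian_effectiveAction_torus_of_letters {v u : ℝ → ℝ} (hv : ∀ t, HasDerivAt v (u t) t)
    (hu : ∀ t, HasDerivAt u (u' t) t)
    {σ : lp (fun _ : X d => ℝ) ∞ → lp (fun _ : X d => ℝ) ∞} {σt : (Site d s → ℝ) → (Site d ((n + 1) * s) → ℝ)}
    (hσt : ∀ wt, σt wt = Rf (σ (Ec wt))) {ρ : ℝ} {wt : Site d s → ℝ} (hwt : wt ∈ ball (0 : Site d s → ℝ) ρ)
    {Df : (Site d s → ℝ) → (lp (fun _ : X d => ℝ) ∞ →L[ℝ] lp (fun _ : X d => ℝ) ∞)}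
    (hDer : ∀ w' ∈ ball (0 : Site d s → ℝ) ρ, HasFDerivAt σ (Df w') (Ec w'))
    (hsec : ∀ w' ∈ ball (0 : Site d s → ℝ) ρ, ∀ k : Site d s → ℝ, Rc (Dop (Ef (((Rf.comp (Df w')).comp Ec) k))) = k)
    (heq : ∀ w' ∈ ball (0 : Site d s → ℝ) ρ, ∀ p : X d, Aop (Ef (σt w')) p + u (Ef (σt w') p)
      = (((n : ℝ) + 1) ^ d)⁻¹ * ∑ p' ∈ B n (blk n p), (Aop (Ef (σt w')) p' + u (Ef (σt w') p')))
    (hEfσ : Ef (σt wt) = σ (Ec wt)) (hEfD : ∀ vt, Ef (((Rf.comp (Df wt)).comp Ec) vt) = Df wt (Ec vt))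
    (hfib : ∀ k : Site d s → ℝ, Pop (Aop (Df wt (Ec k)) + N' (σ (Ec wt)) (Df wt (Ec k))) = 0) :
    ∃ H2 : (Site d s → ℝ) →L[ℝ] (Site d s → ℝ) →L[ℝ] ℝ,
      HasFDerivAt (fderiv ℝ ((fun φ : Site d ((n + 1) * s) → ℝ =>
          (1 / 2 : ℝ) * ∑ x, φ x * ((Rf.comp Aop).comp Ef) φ x + ∑ x, v (φ x)) ∘ σt)) H2 wt ∧
      ∀ k k' : Site d s → ℝ, H2 k k'
        = ((n : ℝ) + 1) ^ d * ∑ y : Site d s, ((Rc.comp Dop).comp ((Aop + N' (σ (Ec wt))).comp ((Df wt).comp Ec))) k y * k' y :=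
  hessian_effectiveAction ((Rf.comp Aop).comp Ef) (torus_operator_form_symm n a s hA hEf hRf) hv hu σt
    (Dt := fun w' => (Rf.comp (Df w')).comp Ec) ((Rc.comp Dop).comp Ef) (isOpen_ball.mem_nhds hwt)
    (fun w' hw' => hasFDerivAt_torus_background n s hσt (hDer w' hw')) (fun w' hw' k => hsec w' hw' k)
    (fun w' hw' => ⟨fun y => (((n : ℝ) + 1) ^ d)⁻¹ * ∑ p' ∈ B n (windowMap d s y), (Aop (Ef (σt w')) p' + u (Ef (σt w') p')),
      pairing_of_sitewise n a s hD hA hEf hRf hRc (σt w') u (heq w' hw')⟩)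
    (linearised_pairing n a s hD hA hP hN' hEf hRf hRc hσt hEfσ hEfD hfib)

end Letters

/-! ## §3. The instance on SBTL's localised small-field background -/

/-- **THE HESSIAN OF THE TORUS EFFECTIVE ACTION AT THE SMALL-FIELD BACKGROUND IS THE BLOCK VOLUME TIMES (65)'s NEXT-SCALE OPERATOR
CONJUGATED TO THE TORUS** (`d ≥ 3`; SBTL's binders VERBATIM + a primitive `v` of `u`; every coarse period `s ≥ 1`): SBTL's
`Q′ ∕ A ∕ N′ ∕ σ`, carrier maps and torus background re-exported with their actions, `σt 0 = 0` and SBTL's closed-ball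
identification VERBATIM (`σt wt ∈ closedBall 0 r`, `Ef(σt wt) = σ(Ec wt)`, `Q′(Ef(σt wt)) = Ec wt`, `Rc(Q′(Ef(σt wt))) = wt`, the
sitewise equation — the five letters that PIN `σt` by SBTL's torus uniqueness), AND on the open torus ball `‖wt‖ < (N⁻¹ − c)r`:
`σ` is differentiable at `Ec wt` and `∃ H2, HasFDerivAt (fderiv (S∘σt)) H2 wt ∧
H2 k k′ = (n+1)^d·Σ_y (Rc(Q′(A(Dσ(Ec k)) + N′(σ(Ec wt))(Dσ(Ec k))))) y·k′ y` with `Dσ := fderiv ℝ σ (Ec wt)`. [folklore] -/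
theorem exists_effectiveAction_hessian_torus (hd : 3 ≤ d) (n : ℕ) {a : ℝ} (ha : 0 < a)
    {v u u' : ℝ → ℝ} (hv : ∀ t, HasDerivAt v (u t) t) (hu : ∀ t, HasDerivAt u (u' t) t) (hu0 : u 0 = 0) {lam c N : ℝ≥0}
    (hlam : ∀ t, |u' t| ≤ lam) {L : ℝ} (hL0 : 0 ≤ L) (hL : ∀ s t, |u' s - u' t| ≤ L * |s - t|)
    (hN : cHs d a * latticeConst d (deltaH d a)
        + ((cG0 d * cKL d (d - 2) + cSplit d a) * Real.exp (2 * deltaU d a)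
            + cFar d a * Real.exp (4 * deltaU d a) / deltaU d a ^ 2) * latticeConst d (deltaU d a / 4)
          * (1 + cHs d a * latticeConst d (deltaH d a)) ≤ (N : ℝ))
    (hc : 2 * lam ≤ c) (hcN : c < N⁻¹) {r : ℝ} (hr : 0 ≤ r) (s : ℕ) [NeZero s] :
    ∃ (Dop Aop : lp (fun _ : X d => ℝ) ∞ →L[ℝ] lp (fun _ : X d => ℝ) ∞)
      (N' : lp (fun _ : X d => ℝ) ∞ → (lp (fun _ : X d => ℝ) ∞ →L[ℝ] lp (fun _ : X d => ℝ) ∞))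
      (σ : lp (fun _ : X d => ℝ) ∞ → lp (fun _ : X d => ℝ) ∞)
      (Ef : (Site d ((n + 1) * s) → ℝ) →L[ℝ] lp (fun _ : X d => ℝ) ∞)
      (Rf : lp (fun _ : X d => ℝ) ∞ →L[ℝ] (Site d ((n + 1) * s) → ℝ))
      (Ec : (Site d s → ℝ) →L[ℝ] lp (fun _ : X d => ℝ) ∞)
      (Rc : lp (fun _ : X d => ℝ) ∞ →L[ℝ] (Site d s → ℝ))
      (σt : (Site d s → ℝ) → (Site d ((n + 1) * s) → ℝ)),
      (∀ (f : lp (fun _ : X d => ℝ) ∞) (y : X d), Dop f y = (((n : ℝ) + 1) ^ d)⁻¹ * ∑ p ∈ B n y, f p) ∧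
      (∀ (f : lp (fun _ : X d => ℝ) ∞) (p : X d), Aop f p = ∑ r ∈ nbhd n p, AX n a p r * f r) ∧
      (∀ (φ h : lp (fun _ : X d => ℝ) ∞) (p : X d), N' φ h p = u' (φ p) * h p) ∧
      (∀ (g : Site d ((n + 1) * s) → ℝ) (q : X d), Ef g q = g (siteOf d ((n + 1) * s) q)) ∧
      (∀ (h : lp (fun _ : X d => ℝ) ∞) (x : Site d ((n + 1) * s)), Rf h x = h (windowMap d ((n + 1) * s) x)) ∧
      (∀ (g : Site d s → ℝ) (q : X d), Ec g q = g (siteOf d s q)) ∧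
      (∀ (h : lp (fun _ : X d => ℝ) ∞) (x : Site d s), Rc h x = h (windowMap d s x)) ∧
      (∀ wt, σt wt = Rf (σ (Ec wt))) ∧ σt 0 = 0 ∧
      -- SBTL's closed-ball identification of the torus background (the closed-ball FIVE, verbatim): it PINS `σt` — by SBTL's
      -- torus-uniqueness clause ∕ (74) `eq_of_sitewise` any torus field with these block means and this sitewise equation IS `σt wt`
      (∀ wt ∈ closedBall (0 : Site d s → ℝ) (((N : ℝ)⁻¹ - c) * r),
        σt wt ∈ closedBall 0 r ∧ Ef (σt wt) = σ (Ec wt) ∧ Dop (Ef (σt wt)) = Ec wt ∧ Rc (Dop (Ef (σt wt))) = wt ∧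
          ∀ p : X d, Aop (Ef (σt wt)) p + u (Ef (σt wt) p)
            = (((n : ℝ) + 1) ^ d)⁻¹ * ∑ p' ∈ B n (blk n p), (Aop (Ef (σt wt)) p' + u (Ef (σt wt) p'))) ∧
      -- THE HESSIAN OF THE TORUS EFFECTIVE ACTION on the open torus ball
      ∀ wt ∈ ball (0 : Site d s → ℝ) (((N : ℝ)⁻¹ - c) * r),
        DifferentiableAt ℝ σ (Ec wt) ∧
        ∃ H2 : (Site d s → ℝ) →L[ℝ] (Site d s → ℝ) →L[ℝ] ℝ,
          HasFDerivAt (fderiv ℝ ((fun φ : Site d ((n + 1) * s) → ℝ =>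
              (1 / 2 : ℝ) * ∑ x, φ x * ((Rf.comp Aop).comp Ef) φ x + ∑ x, v (φ x)) ∘ σt)) H2 wt ∧
          ∀ k k' : Site d s → ℝ, H2 k k'
            = ((n : ℝ) + 1) ^ d * ∑ y : Site d s,
                Rc (Dop (Aop (fderiv ℝ σ (Ec wt) (Ec k)) + N' (σ (Ec wt)) (fderiv ℝ σ (Ec wt) (Ec k)))) y * k' y := by
  obtain ⟨Dop, Aop, Pop, N', σ, Cf, Ef, Rf, Ec, Rc, σt, hD, hA, hP, hN'app, -, -, -, hint, -, hEf, hRf, hEc, hRc, -, -, hEcn, -,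
    hσt, hσt0, hball, -, -, htorus⟩ := exists_background_torus_localised hd n ha hu hu0 hlam hL0 hL hN hc hcN hr s
  refine ⟨Dop, Aop, N', σ, Ef, Rf, Ec, Rc, σt, hD, hA, hN'app, hEf, hRf, hEc, hRc, hσt, hσt0, hball, fun wt hwt => ?_⟩
  -- the response family `w′ ↦ fderiv ℝ σ (Ec w′)` on the open torus ball, with SBTL's letters transported along `HasFDerivAt.fderiv`
  have hDer : ∀ w' ∈ ball (0 : Site d s → ℝ) (((N : ℝ)⁻¹ - c) * r), HasFDerivAt σ (fderiv ℝ σ (Ec w')) (Ec w') :=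
    fun w' hw' => by
      obtain ⟨⟨D, hDσ, -, -, -, -⟩, -, -, -⟩ := htorus w' hw'
      exact hDσ.differentiableAt.hasFDerivAt
  have hsec : ∀ w' ∈ ball (0 : Site d s → ℝ) (((N : ℝ)⁻¹ - c) * r), ∀ k : Site d s → ℝ,
      Rc (Dop (Ef (((Rf.comp (fderiv ℝ σ (Ec w'))).comp Ec) k))) = k := fun w' hw' k => by
    obtain ⟨⟨D, hDσ, -, -, -, hsecD⟩, -, -, -⟩ := htorus w' hw'
    rw [hDσ.fderiv]
    exact hsecD k
  have heq : ∀ w' ∈ ball (0 : Site d s → ℝ) (((N : ℝ)⁻¹ - c) * r), ∀ p : X d, Aop (Ef (σt w')) p + u (Ef (σt w') p)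
      = (((n : ℝ) + 1) ^ d)⁻¹ * ∑ p' ∈ B n (blk n p), (Aop (Ef (σt w')) p' + u (Ef (σt w') p')) :=
    fun w' hw' => (hball w' (ball_subset_closedBall hw')).2.2.2.2
  have hEfσ : Ef (σt wt) = σ (Ec wt) := (hball wt (ball_subset_closedBall hwt)).2.1
  obtain ⟨⟨D, hDσ, -, hEfD, -, -⟩, -, -, -⟩ := htorus wt hwt
  have hEfD' : ∀ vt, Ef (((Rf.comp (fderiv ℝ σ (Ec wt))).comp Ec) vt) = fderiv ℝ σ (Ec wt) (Ec vt) := fun vt => by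
    rw [hDσ.fderiv]
    exact hEfD vt
  -- (63)'s interior package at `Ec wt` (in (63)'s open ball since `‖Ec wt‖ = ‖wt‖`): the linearised fibre equation for ITS response,
  -- which is `fderiv ℝ σ (Ec wt)` by uniqueness of the derivative
  have hballEc : Ec wt ∈ ball (0 : lp (fun _ : X d => ℝ) ∞) (((N : ℝ)⁻¹ - c) * r) := by
    rw [mem_ball_zero_iff] at hwt ⊢
    rwa [hEcn]
  obtain ⟨⟨D', hD'σ, -, -, hfibD', -⟩, -⟩ := hint (Ec wt) hballEc
  have hfib : ∀ k : Site d s → ℝ,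
      Pop (Aop (fderiv ℝ σ (Ec wt) (Ec k)) + N' (σ (Ec wt)) (fderiv ℝ σ (Ec wt) (Ec k))) = 0 := fun k => by
    rw [hD'σ.fderiv]
    exact hfibD' (Ec k)
  obtain ⟨H2, hH2, hH2app⟩ := hessian_effectiveAction_torus_of_letters n a s hD hA hP hN'app hEf hRf hRc hv hu hσt hwt hDer
    hsec heq hEfσ hEfD' hfib
  refine ⟨hDσ.differentiableAt, H2, hH2, fun k k' => ?_⟩
  rw [hH2app k k']
  simp only [ContinuousLinearMap.comp_apply, add_apply]

/-! ## §4. Toy -/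

/-- Toy: the `side n • (s • t)` spelling of PTC's periodicity at `n = 0`, `s = 1`, for ANY periodisation map with the displayed action. -/
example {Ef : (Site d ((0 + 1) * 1) → ℝ) →L[ℝ] lp (fun _ : X d => ℝ) ∞}
    (hEf : ∀ (g : Site d ((0 + 1) * 1) → ℝ) (q : X d), Ef g q = g (siteOf d ((0 + 1) * 1) q))
    (g : Site d ((0 + 1) * 1) → ℝ) (q t : X d) :
    (Ef g : X d → ℝ) (q + side 0 • (((1 : ℕ) : ℤ) • t)) = Ef g q :=
  periodise_periodic_side 0 1 hEf g q t

end Summit.QuantumFields.BalabanUV.T4Continuum.NE7b.SupTorusEffectiveActionHessian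

end
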